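import Summits.QuantumFields.YangMills.Theorems.LuscherReductionTwistedTraceScalingBOStiffDoorSlack
import HarnessLib

/-!
# (B-ST) stub (L-3a), abstract layer: the `hgap` input of `kform_bilinear_bound` FROM the slack door — general `h ⊥_w Θ` via `g := h/Θ`
# (lane A of S-BASE, crux `TwistedTraceScaling` stmt-QuantumFields-20203, C4-CORE, the (B-ST) pen; HANDOFF-g21 STUB LEDGER (L-3), Θ-floor remark UPDATE 19:55Z)

`…BOStiffDoorSlack.form_le_of_quasimode_of_comparison_slack` bounds `∫∫ (gΘ)M(gΘ)` for a product ansatz `gΘ`; `…BOStiffFibreBilinear.kform_bilinear_bound` wants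
`hgap : ∀ h ⊥_w Θ` supported in `S`, `∫∫ hMh ≤ Λ(1 − θ₁)∫h²w`.  When `Θ` has a positive floor on `S` (the cap-restricted frozen profile is NOT tapered: it equals
`e^{−|P_Γx|²β²} e^{−q(x)}` on its closed support ball) every such `h` IS a product `(h/Θ)·Θ` with `h/Θ` bounded, and the orthogonality kills the mean term of the door:
★★★ `hgap_of_door` — the literal `hgap` shape with `1 − θ₁ = 1 + η − (c_J/(C_νP₀))(1 − C_ν δ C'_ν)`, from the door hypotheses with `hflat` assumed for every bounded measurable
`g` vanishing off `S`.
HONEST FRAMING: bookkeeping for a stub of a child of the CONDITIONAL route R2b1; (B-ST) OPEN; C4-CORE OPEN; not infinite volume, not a gap, not Clay.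
-/

set_option autoImplicit false

noncomputable section

open MeasureTheory

namespace Summit.QuantumFields.YangMills.Theorems.FemtoTransferGap.StiffDoor

variable {X : Type*} [MeasurableSpace X] {μ : Measure X} [IsFiniteMeasure μ]

section GapDoor

variable {M J₀ : X → X → ℝ} {Θ w D : X → ℝ} {CM CΘ Cw CD CJ : ℝ} {S : Set X} {η Λ Cν C'ν cJ P₀ δ θ₀ : ℝ}

/-- The quotient `h/Θ` on `S` (zero off `S`): measurable, bounded by `C_h/θ₀`, and `(h/Θ)·Θ = h` when `h` vanishes off `S` and `Θ ≥ θ₀ > 0` on `S`. [folklore] -/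
theorem div_profile_props {h : X → ℝ} (hh : Measurable h) {Ch : ℝ} (hhb : ∀ x, |h x| ≤ Ch) (hhS : ∀ x, x ∉ S → h x = 0) (hΘ : Measurable Θ) (hS : MeasurableSet S)
    (hθ₀ : 0 < θ₀) (hΘlo : ∀ x ∈ S, θ₀ ≤ Θ x) :
    Measurable (fun x => S.indicator (fun x => h x / Θ x) x) ∧ (∀ x, |S.indicator (fun x => h x / Θ x) x| ≤ Ch / θ₀) ∧
      (∀ x, x ∉ S → S.indicator (fun x => h x / Θ x) x = 0) ∧ ∀ x, S.indicator (fun x => h x / Θ x) x * Θ x = h x := by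
  refine ⟨(hh.div hΘ).indicator hS, fun x => ?_, fun x hx => Set.indicator_of_notMem hx _, fun x => ?_⟩
  · by_cases hx : x ∈ S
    · rw [Set.indicator_of_mem hx, abs_div]
      have hΘx : θ₀ ≤ Θ x := hΘlo x hx
      have hΘpos : 0 < Θ x := hθ₀.trans_le hΘx
      rw [abs_of_pos hΘpos]
      exact (div_le_div_of_nonneg_left (abs_nonneg _) hθ₀ hΘx).trans (div_le_div_of_nonneg_right (hhb x) hθ₀.le)
    · rw [Set.indicator_of_notMem hx, abs_zero]; exact div_nonneg ((abs_nonneg _).trans (hhb x)) hθ₀.le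
  · by_cases hx : x ∈ S
    · rw [Set.indicator_of_mem hx]
      have hΘpos : 0 < Θ x := hθ₀.trans_le (hΘlo x hx)
      field_simp
    · rw [Set.indicator_of_notMem hx, zero_mul, hhS x hx]

/-- ★★★ **`hgap` from the slack door.**  Under the door hypotheses of `form_le_of_quasimode_of_comparison_slack` (upper quasimode on `S`, two-sided weight comparison with
the flat reference `D` on `S`, jump floor `c_J Λ J₀ ≤ ΘMΘ`, flat Poincaré with killing slack `δ` for EVERY bounded measurable `g` vanishing off `S`) and a floor `Θ ≥ θ₀ > 0`
on `S`: every bounded measurable `h` vanishing off `S` with `∫ hΘw = 0` has `∫∫ hMh ≤ Λ·(1 + η − (c_J/(C_νP₀))(1 − C_νδC'_ν))·∫ h²w` — literally the `hgap` input of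
`…BOStiffFibreBilinear.kform_bilinear_bound`. [folklore] -/
theorem hgap_of_door (hM : Measurable (Function.uncurry M)) (hMb : ∀ x y, |M x y| ≤ CM) (hsymm : ∀ x y, M x y = M y x)
    (hΘ : Measurable Θ) (hΘb : ∀ x, |Θ x| ≤ CΘ) (hΘ0 : ∀ x, 0 ≤ Θ x) (hθ₀ : 0 < θ₀) (hΘlo : ∀ x ∈ S, θ₀ ≤ Θ x)
    (hw : Measurable w) (hwb : ∀ x, |w x| ≤ Cw) (hD : Measurable D) (hDb : ∀ x, |D x| ≤ CD) (hJ₀ : Measurable (Function.uncurry J₀)) (hJ₀b : ∀ x y, |J₀ x y| ≤ CJ)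
    (hS : MeasurableSet S) (hZ : 0 < ∫ x in S, Θ x ^ 2 * w x ∂μ) (hZD : 0 < ∫ x in S, D x ∂μ) (hΛ : 0 < Λ)
    (hq : ∀ x ∈ S, ∫ y, M x y * Θ y ∂μ ≤ (1 + η) * Λ * (Θ x * w x)) (hν : ∀ x ∈ S, Θ x ^ 2 * w x ≤ Cν * D x) (hCν : 0 < Cν)
    (hν' : ∀ x ∈ S, D x ≤ C'ν * (Θ x ^ 2 * w x)) (hJ : ∀ x y, cJ * (Λ * J₀ x y) ≤ Θ x * M x y * Θ y) (hcJ : 0 < cJ) (hP₀ : 0 < P₀) (hδ : 0 ≤ δ)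
    (hflat : ∀ g : X → ℝ, Measurable g → (∃ C : ℝ, ∀ x, |g x| ≤ C) → (∀ x, x ∉ S → g x = 0) →
      (∫ x in S, g x ^ 2 * D x ∂μ) - (∫ x in S, g x * D x ∂μ) ^ 2 / (∫ x in S, D x ∂μ) ≤
        P₀ * ((1 / 2) * ∫ x, ∫ y, (g x - g y) ^ 2 * J₀ x y ∂μ ∂μ) + δ * ∫ x in S, g x ^ 2 * D x ∂μ) :
    ∀ h : X → ℝ, Measurable h → (∃ C : ℝ, ∀ x, |h x| ≤ C) → (∀ x, x ∉ S → h x = 0) → ∫ x, h x * Θ x * w x ∂μ = 0 →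
      ∫ x, ∫ y, h x * M x y * h y ∂μ ∂μ ≤ Λ * ((1 + η - (cJ / (Cν * P₀)) * (1 - Cν * δ * C'ν)) * ∫ x, h x ^ 2 * w x ∂μ) := by
  intro h hh hC hhS horth
  obtain ⟨Ch, hhb⟩ := hC
  obtain ⟨hgm, hgb, hgS, hgΘ⟩ := div_profile_props (S := S) hh hhb hhS hΘ hS hθ₀ hΘlo
  set g := fun x => S.indicator (fun x => h x / Θ x) x
  have hdoor := form_le_of_quasimode_of_comparison_slack (μ := μ) hM hMb hsymm hΘ hΘb hΘ0 hgm hgb hgS hw hwb hD hDb hJ₀ hJ₀b hS hZ hZD hΛ hq hν hCν hν' hJ hcJ hP₀ hδ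
    (hflat g hgm ⟨_, hgb⟩ hgS)
  -- substitute `gΘ = h`
  have e1 : ∫ x, ∫ y, (g x * Θ x) * M x y * (g y * Θ y) ∂μ ∂μ = ∫ x, ∫ y, h x * M x y * h y ∂μ ∂μ := by
    refine integral_congr_ae (ae_of_all _ fun x => integral_congr_ae (ae_of_all _ fun y => ?_)); dsimp only; rw [hgΘ x, hgΘ y]
  have e2 : ∫ x, g x ^ 2 * (Θ x ^ 2 * w x) ∂μ = ∫ x, h x ^ 2 * w x ∂μ := by
    refine integral_congr_ae (ae_of_all _ fun x => ?_); dsimp only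
    have := hgΘ x
    calc g x ^ 2 * (Θ x ^ 2 * w x) = (g x * Θ x) ^ 2 * w x := by ring
      _ = h x ^ 2 * w x := by rw [this]
  have e3 : ∫ x, g x * (Θ x ^ 2 * w x) ∂μ = 0 := by
    rw [← horth]
    refine integral_congr_ae (ae_of_all _ fun x => ?_); dsimp only
    have := hgΘ x
    calc g x * (Θ x ^ 2 * w x) = (g x * Θ x) * Θ x * w x := by ring
      _ = h x * Θ x * w x := by rw [this]
  rw [e1, e2, e3] at hdoor
  simpa using hdoor

end GapDoor

end Summit.QuantumFields.YangMills.Theorems.FemtoTransferGap.StiffDoor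

end
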